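import Literature.Probability.Percolation.RussoFormula
import Literature.Probability.Percolation.SharpnessDCTProofs
import Literature.Probability.Percolation.BernoulliPercolation
import HarnessLib

/-!
# `stub_pivotalOpen` of line `Sketch` (crux `PercTreeValue.EquilateralAntiFactorisation`,
# stmt-CriticalPhenomena-7800): `E_p[N_E ; E] = p · E_p[N_E]`

Registered stub `stub_pivotalOpen` of the lead's skeleton for the crux
`Summit.CriticalPhenomena.PercolationContinuityZ3.Theses.PercTreeValue.EquilateralAntiFactorisation`
(line `Sketch`, idea `pivotal-deficit-flow`). It is the reading lemma converting Russo's
unconditional pivotal count (`russo_formula_holds`: `d/dq P_q(E) = E_q[N_E]`,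
`N_E(ω) = #(pivotals E ω ∩ E(G))`) into the conditional one: for an increasing local event `E`
of Bernoulli bond percolation `P_p` on a graph `G`,

  `∫_E N_E dP_p = p · ∫ N_E dP_p`.

Proof (Russo 1981, §4; Grimmett 1999, §2.4): for a finite set `F` of pairs determining `E`,
`N_E = Σ_{e ∈ F} 1[e ∈ E(G), e pivotal]` (pivotal pairs lie in `F`, `Russo.mem_of_isPivotal`), so
both sides are finite sums and it suffices to show `P_p(E ∩ {e pivotal}) = p · P_p(e pivotal)` for
`e ∈ F ∩ E(G)`. On `{e pivotal}` one has `ω ∈ E ↔ e ∈ ω` (`E` increasing), so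
`E ∩ {e pivotal} = {e open} ∩ {e pivotal}`; the event `{e pivotal}` is determined by `F ∖ {e}`
(`Russo.determinedBy_isPivotal`), hence independent of `{e open}`
(`DCT16.real_inter_of_determinedBy_disjoint`), and `P_p(e open) = p` (`bondPercolation_cylinder`).

Helper lemmas live in the sub-namespace `PivotalOpen`.
-/

noncomputable section

namespace Summit.CriticalPhenomena.PercolationContinuityZ3.Theorems.EquilateralAntiFactorisation

open MeasureTheory
open Literature.Probability.Percolation

namespace PivotalOpen

variable {V : Type*}

/-- On the event that `e` is pivotal for the increasing event `E`, membership in `E` is the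
state of `e`: `ω ∈ E ↔ e ∈ ω` (if `e ∈ ω` then `ω = insert e ω ∈ E`; if `e ∉ ω` then
`ω = ω ∖ {e} ∉ E`). -/
theorem mem_iff_mem_of_isPivotal {E : Set (BondConfig V)} (hE : IsUpperSet E) {e : Sym2 V}
    {ω : BondConfig V} (h : IsPivotal E e ω) : ω ∈ E ↔ e ∈ ω := by
  by_cases he : e ∈ ω
  · have hins : insert e ω = ω := Set.insert_eq_of_mem he
    unfold IsPivotal at h
    rw [hins] at h
    refine ⟨fun _ => he, fun _ => ?_⟩
    rcases h with ⟨h1, -⟩ | ⟨h1, h2⟩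
    · exact h1
    · exact (h2 (hE Set.sdiff_subset h1)).elim
  · rw [Russo.isPivotal_iff_of_notMem hE he] at h
    exact ⟨fun hω => (h.2 hω).elim, fun heω => (he heω).elim⟩

/-- `P_p({e ∈ E(G) pivotal} ∩ E) = p · P_p(e ∈ E(G) pivotal)` for an increasing event `E`
determined by the finite set `F`: on `{e pivotal}` the event `E` coincides with `{e open}`
(`mem_iff_mem_of_isPivotal`), `{e pivotal}` is determined by `F ∖ {e}`
(`Russo.determinedBy_isPivotal`) hence independent of `{e open}`
(`DCT16.real_inter_of_determinedBy_disjoint`), and `P_p(e open) = p`. -/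
theorem real_pivotal_inter [Countable V] (G : SimpleGraph V) (p : unitInterval)
    {E : Set (BondConfig V)} (hE : IsUpperSet E) {F : Finset (Sym2 V)}
    (hF : DeterminedBy E (↑F : Set (Sym2 V))) (e : Sym2 V) :
    (bondPercolation G p).real ({ω : BondConfig V | e ∈ G.edgeSet ∧ IsPivotal E e ω} ∩ E) =
      (p : ℝ) *
        (bondPercolation G p).real {ω : BondConfig V | e ∈ G.edgeSet ∧ IsPivotal E e ω} := by
  classical
  by_cases heE : e ∈ G.edgeSet
  · have h1 : {ω : BondConfig V | e ∈ G.edgeSet ∧ IsPivotal E e ω} =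
        {ω | IsPivotal E e ω} := by
      ext ω; simp [heE]
    have h2 : {ω : BondConfig V | IsPivotal E e ω} ∩ E =
        {ω | IsPivotal E e ω} ∩ {ω | e ∈ ω} := by
      ext ω
      simp only [Set.mem_inter_iff, Set.mem_setOf_eq]
      constructor
      · rintro ⟨hpiv, hω⟩
        exact ⟨hpiv, (mem_iff_mem_of_isPivotal hE hpiv).1 hω⟩
      · rintro ⟨hpiv, hω⟩
        exact ⟨hpiv, (mem_iff_mem_of_isPivotal hE hpiv).2 hω⟩
    have hA : DeterminedBy {ω : BondConfig V | IsPivotal E e ω} ↑(F.erase e) :=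
      Russo.determinedBy_isPivotal hF e
    have hB : DeterminedBy {ω : BondConfig V | e ∈ ω} ↑({e} : Finset (Sym2 V)) := by
      rw [Finset.coe_singleton]
      exact determinedBy_mem e
    have hdisj : Disjoint (F.erase e) {e} := by
      rw [Finset.disjoint_singleton_right]
      exact Finset.notMem_erase e _
    rw [h1, h2, DCT16.real_inter_of_determinedBy_disjoint G p hA hB hdisj,
      bondPercolation_cylinder G p heE, mul_comm]
  · have h1 : {ω : BondConfig V | e ∈ G.edgeSet ∧ IsPivotal E e ω} = ∅ := by
      ext ω; simp [heE]
    rw [h1, Set.empty_inter, measureReal_empty, mul_zero]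

end PivotalOpen

/-- **S2 (pivotality is independent of the edge's own state).** For an increasing local event
`E` of Bernoulli bond percolation `P_p` on `G`, the expected number of pivotal edges restricted
to `E` is `p` times the unrestricted expectation: `E_p[N_E ; E] = p · E_p[N_E]`,
`N_E(ω) = #(pivotals E ω ∩ E(G))`. On `E` the pivotal edges are open, off `E` they are closed,
and `{e pivotal}` is independent of `{e open}` (Russo 1981, §4; Grimmett 1999, §2.4). -/
theorem stub_pivotalOpen {V : Type*} [Countable V] (G : SimpleGraph V) (p : unitInterval)
    {E : Set (BondConfig V)} (hE : IsUpperSet E) (hEl : IsLocalEvent E) :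
    ∫ ω in E, ((pivotals E ω ∩ G.edgeSet).encard.toNat : ℝ) ∂(bondPercolation G p) =
      (p : ℝ) * ∫ ω, ((pivotals E ω ∩ G.edgeSet).encard.toNat : ℝ) ∂(bondPercolation G p) := by
  classical
  obtain ⟨F, hF⟩ := hEl
  -- the events `{e ∈ E(G) ∧ e pivotal}` are measurable (determined by `F \ {e}`, or empty)
  have hmeas : ∀ e ∈ F, MeasurableSet {ω : BondConfig V | e ∈ G.edgeSet ∧ IsPivotal E e ω} := by
    intro e _
    by_cases heE : e ∈ G.edgeSet
    · have : {ω : BondConfig V | e ∈ G.edgeSet ∧ IsPivotal E e ω} = {ω | IsPivotal E e ω} := by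
        ext ω; simp [heE]
      rw [this]
      exact (Russo.determinedBy_isPivotal hF e).measurableSet_of_finset
    · have : {ω : BondConfig V | e ∈ G.edgeSet ∧ IsPivotal E e ω} = ∅ := by
        ext ω; simp [heE]
      rw [this]
      exact MeasurableSet.empty
  -- Russo's (4.1): the pivotal count is the sum of the indicators over `F`
  have hcount : ∀ ω : BondConfig V, ((pivotals E ω ∩ G.edgeSet).encard.toNat : ℝ) =
      ∑ e ∈ F, {ω : BondConfig V | e ∈ G.edgeSet ∧ IsPivotal E e ω}.indicator 1 ω := by
    intro ω
    have hset : pivotals E ω ∩ G.edgeSet =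
        ↑(F.filter fun e => e ∈ G.edgeSet ∧ IsPivotal E e ω) := by
      ext e
      simp only [Set.mem_inter_iff, mem_pivotals, Finset.coe_filter, Set.mem_setOf_eq]
      constructor
      · rintro ⟨hpiv, heE⟩
        exact ⟨Russo.mem_of_isPivotal hF hpiv, heE, hpiv⟩
      · rintro ⟨-, heE, hpiv⟩
        exact ⟨hpiv, heE⟩
    rw [hset, Set.encard_coe_eq_coe_finsetCard, ENat.toNat_coe, Finset.card_filter]
    push_cast
    refine Finset.sum_congr rfl fun e _ => ?_
    simp only [Set.indicator, Set.mem_setOf_eq, Pi.one_apply]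
  simp_rw [hcount]
  rw [integral_finsetSum, integral_finsetSum, Finset.mul_sum]
  · refine Finset.sum_congr rfl fun e he => ?_
    rw [integral_indicator_one (hmeas e he), integral_indicator_one (hmeas e he),
      measureReal_restrict_apply (hmeas e he)]
    exact PivotalOpen.real_pivotal_inter G p hE hF e
  · intro e he
    exact (integrable_const (1 : ℝ)).indicator (hmeas e he)
  · intro e he
    exact (integrable_const (1 : ℝ)).indicator (hmeas e he)

end Summit.CriticalPhenomena.PercolationContinuityZ3.Theorems.EquilateralAntiFactorisation

end
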